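import Mathlib
import Summits.NavierStokesRegularity.NavierStokesRegularity.Theorems.BarrierStepRungThreeCertificateTemplate
import Summits.NavierStokesRegularity.NavierStokesRegularity.Theses.BarrierStepRungThree
import HarnessLib

/-!
# The certificate template, concluding the RE-TYPED ∃-crux `BarrierCertificateR` by name
  (route `BarrierStepRungThree`, item stmt-NavierStokesRegularity-24513)

The planner re-typed the line's ∃-crux (generation 3): `Theses.BarrierStepRungThree.BarrierCertificateR`
is VERBATIM the repaired certificate format K2″ (the hypothesis of `taoLadderRungThree_target_of_certificate₃` /
`noGlobalCascade_of_certificate₃`).  This file restates the certificate TEMPLATE of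
`BarrierStepRungThreeCertificateTemplate.lean` with that item as conclusion: from the table, the constants,
the profile kit's NUMERIC side conditions (for Design Two all proved: `CertificateProfile.designTwo_numerics`),
the window-cap clause with the explicit slack bound, the absorption budget, and the FIVE BOX statements about
`(v, g)` (datum, properness, floor, gradient bound, undisturbed decrease `≤ -(γ+δ)` on the box, goal ⇒ window
re-entry), conclude `BarrierCertificateR` — so that a rational SOS certificate for the box clauses closes the
item by `exact`.  Composition: profile kit (`CertificateProfile.certificateProfileKit`) + ns-bsr3-p5's
`WindowBox.region_bounds` / `decrease_of_box_le` / `certificate₃_of_windowCertificateMarginSplit₃`.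

HONEST FRAMING: an implication about Tao-type MODEL lattice data (rung TL-M3 line); NO certificate is produced —
the box clauses for SOME comparable table remain the open ∃-crux; nothing here is a statement about the
Navier–Stokes equations and NS regularity is not proved by any of this.
-/

noncomputable section

-- the sub-problem namespace repeats the summit name by design (D-0017)
set_option linter.dupNamespace false

namespace Summit.NavierStokesRegularity.NavierStokesRegularity.Theorems

open Literature.Analysis.FluidPDE Literature.Analysis.FluidPDE.TaoCascade

/-- **`BarrierCertificateR` (item stmt-NavierStokesRegularity-24513) from a BOX certificate with the profile
kit.** Same hypotheses as `taoLadderRungThree_target_of_boxCertificateKit`; conclusion: the route's re-typed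
∃-crux BY NAME.  [cite: Tao2016AveragedNS, §6.4 Prop. 6.5 with §6.1–6.2 and §4 (4.5)–(4.10);
PrajnaRantzer2007 Thm 3.5 and §3.4 (robust eventuality certificates)] -/
theorem barrierCertificateR_of_boxCertificateKit
    {R θ c η γ δ Λ : ℝ} {i₀ : Fin 4} {α : Fin 4 → Fin 4 → Fin 4 → ℤ × ℤ × ℤ → ℝ} {X₀ : Fin 4 → ℝ}
    {n : ℕ} {kLo : ℤ} {v g : (Fin 4 → Fin n → ℝ) → ℝ} {Mw Φ : Fin 4 → Fin n → ℝ}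
    {A₀ Aₓ A₁ E_w E₀ q_top Q_b G lam : ℝ}
    -- table, exponents, constants
    (hR : 1 ≤ R) (hα : InTableClass R α) (hX₀ : X₀ i₀ ≠ 0) (hθ0 : 0 ≤ θ) (hθ : θ ≤ 1 / 2)
    (hc : 0 < c) (hη : 0 < η) (hγ : 0 < γ) (hkLo : kLo ≤ 0) (hkn : (2 : ℤ) ≤ kLo + n)
    (hv : ContDiff ℝ 1 v) (hg : Continuous g)
    -- the profile kit's numeric side conditions
    (hA₀ : ∀ i, (∑ i₁ : Fin 4, ∑ i₂ : Fin 4, |α i₁ i₂ i (0, 0, 0)|) ≤ A₀)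
    (hAₓ : ∀ i, (∑ i₁ : Fin 4, ∑ i₂ : Fin 4, |α i₁ i₂ i (1, 0, 0)|) +
      (∑ i₁ : Fin 4, ∑ i₂ : Fin 4, |α i₁ i₂ i (0, 1, 0)|) ≤ Aₓ)
    (hA₁i : ∀ i, (∑ i₁ : Fin 4, ∑ i₂ : Fin 4, |α i₁ i₂ i (0, 0, 1)|) ≤ A₁) (hA₁ : 0 < A₁)
    (hA₁s : (∑ i₁ : Fin 4, ∑ i₂ : Fin 4, ∑ i₃ : Fin 4, |α i₁ i₂ i₃ (0, 0, 1)|) ≤ A₁)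
    (hΦ0 : ∀ i j, 0 ≤ Φ i j) (hΦw : ∀ i j, Φ i j ≤ E_w) (hE₀ : 0 ≤ E₀)
    (hΦ₀ : ∀ (i : Fin 4) (j : Fin n), (j : ℕ) = 0 → Φ i j ≤ E₀) (hqt : 0 < q_top)
    (hΦtop : ∀ (i : Fin 4) (j : Fin n), (j : ℕ) + 1 = n → 2 * Φ i j ≤ q_top ^ 2)
    (hz : 2 * c * A₁ * (2 : ℝ) ^ ((5 : ℝ) * ((kLo + n : ℤ) : ℝ) / 2) * q_top ≤ 1 / 2)
    (hQb : 0 < Q_b) (hG : 0 < G) (hG8 : G ^ 2 < 8) (hlam : lam < 1) (hlamG : (2 : ℝ) ^ θ ≤ lam * G)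
    (hgoal0 : (2 : ℝ) ^ (2 * θ) * (2 * E₀) ≤ (lam * Q_b * G) ^ 2)
    (hT1 : c * ((2 : ℝ) ^ ((5 : ℝ) * ((kLo - 1 : ℤ) : ℝ) / 2) *
        (A₀ * (Q_b * G) ^ 2 + Aₓ * (Q_b * G) * Real.sqrt (2 * E₀)) +
        (2 : ℝ) ^ ((5 : ℝ) * ((kLo - 2 : ℤ) : ℝ) / 2) * (A₁ * (Q_b * G ^ 2) ^ 2)) ≤
        (1 - lam) * (Q_b * G))
    (hT2 : c * Q_b * (2 : ℝ) ^ ((5 : ℝ) * (kLo : ℝ) / 2) * (G * (2 : ℝ) ^ (-(5 : ℝ) / 2)) ^ 2 *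
        (A₀ + Aₓ / G + A₁ * G ^ 2 * (2 : ℝ) ^ (-(5 : ℝ) / 2)) ≤ 1 - lam)
    -- clause 19 with the explicit slack bound, and the absorption budget (split δ)
    (hcap : ∀ (i : Fin 4) (j : Fin n), Mw i j ^ 2 / 2 +
      η * (c * (2 : ℝ) ^ (-(kLo : ℝ)) *
        (Q_b ^ 2 / 2 * (2 : ℝ) ^ ((3 : ℝ) * (kLo : ℝ)) * (8 / (8 - G ^ 2)) +
          n * (2 : ℝ) ^ ((3 : ℝ) * (((kLo + n : ℤ) : ℝ) - 1)) * (E_w + q_top ^ 2 / 2) +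
          4 / 3 * (2 : ℝ) ^ (-(2 : ℝ) * ((kLo + n : ℤ) : ℝ)) / (2 * c * A₁) ^ 2)) +
      η * (1 + 1 : ℝ) ^ ((2 : ℝ) * ((kLo + (j : ℕ) : ℤ) : ℝ)) * c * Φ i j < Φ i j)
    (hΛ : ∀ x : Fin 4 → Fin n → ℝ, v x ≤ 0 → ‖fderiv ℝ v x‖ ≤ Λ) (hΛ0 : 0 ≤ Λ)
    (hbudget : ∀ (i : Fin 4) (j : Fin n),
      Λ * (η * (1 + 1 : ℝ) ^ ((2 : ℝ) * ((kLo + (j : ℕ) : ℤ) : ℝ)) * Real.sqrt (Φ i j)) ≤ δ)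
    -- the box clauses about (v, g)
    (hv0 : v (fun i (j : Fin n) => datumState i₀ X₀ i (kLo + (j : ℕ))) ≤ 0)
    (hg0 : 0 < g (fun i (j : Fin n) => datumState i₀ X₀ i (kLo + (j : ℕ))))
    (hproper : ∀ x : Fin 4 → Fin n → ℝ, v x ≤ 0 → ∀ i j, |x i j| ≤ Mw i j)
    (hfloor : ∀ x : Fin 4 → Fin n → ℝ, v x ≤ 0 → 0 < g x → -(γ * c) < v x)
    (hdec : ∀ S : Fin 4 → ℤ → ℝ, v (fun i (j : Fin n) => S i (kLo + (j : ℕ))) ≤ 0 →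
      (∀ i : Fin 4, |S i (kLo - 1)| ≤ Q_b * G) →
      (∀ i : Fin 4, |S i (kLo + n)| ≤
        2 * c * A₁ * (2 : ℝ) ^ ((5 : ℝ) * ((kLo + n - 1 : ℤ) : ℝ) / 2) * q_top ^ 2) →
      (∀ (i : Fin 4) (j : Fin n), S i (kLo + (j : ℕ)) ^ 2 ≤ 2 * Φ i j) →
      0 < g (fun i (j : Fin n) => S i (kLo + (j : ℕ))) →
      (fderiv ℝ v (fun i (j : Fin n) => S i (kLo + (j : ℕ))))
        (fun i (j : Fin n) => quadTerm 1 α (fun i' k' (_ : ℝ) => S i' k') i (kLo + (j : ℕ)) 0) ≤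
        -(γ + δ))
    (hgoal : ∀ S : Fin 4 → ℤ → ℝ, v (fun i (j : Fin n) => S i (kLo + (j : ℕ))) ≤ 0 →
      (∀ i : Fin 4, |S i (kLo - 1)| ≤ Q_b * G) →
      (∀ i : Fin 4, |S i (kLo + n)| ≤
        2 * c * A₁ * (2 : ℝ) ^ ((5 : ℝ) * ((kLo + n - 1 : ℤ) : ℝ) / 2) * q_top ^ 2) →
      (∀ (i : Fin 4) (j : Fin n), S i (kLo + (j : ℕ)) ^ 2 ≤ 2 * Φ i j) →
      g (fun i (j : Fin n) => S i (kLo + (j : ℕ))) ≤ 0 →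
      (1 + 1 : ℝ) ^ (-θ) ≤ |S i₀ 1| ∧
        v (fun i (j : Fin n) => S i (1 + (kLo + (j : ℕ))) / |S i₀ 1|) ≤ 0 ∧
        0 < g (fun i (j : Fin n) => S i (1 + (kLo + (j : ℕ))) / |S i₀ 1|)) :
    Summit.NavierStokesRegularity.NavierStokesRegularity.Theses.BarrierStepRungThree.BarrierCertificateR := by
  unfold Summit.NavierStokesRegularity.NavierStokesRegularity.Theses.BarrierStepRungThree.BarrierCertificateR
  obtain ⟨r, q, ρ, env, Ψ, h14, h15, h16, h17, h18, h19e, hΨB, h20, hqlo, hqhi, hqpos, h26, h27o⟩ :=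
    CertificateProfile.certificateProfileKit θ c n kLo α Φ A₀ Aₓ A₁ E_w E₀ q_top Q_b G lam hθ hc hkLo
      hkn hA₀ hAₓ hA₁i hA₁ hA₁s hΦ0 hΦw hE₀ hΦ₀ hqt hΦtop hz hQb hG hG8 hlam hlamG hgoal0 hT1 hT2
  have hq0 : ∀ k, 0 ≤ q k := fun k => (hqpos k).le
  -- boundary caps from the profile
  have hbd : ∀ S : Fin 4 → ℤ → ℝ, (∀ (i : Fin 4) (k : ℤ), (k < kLo ∨ kLo + n ≤ k) → |S i k| ≤ q k) →
      (∀ i : Fin 4, |S i (kLo - 1)| ≤ Q_b * G) ∧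
      (∀ i : Fin 4, |S i (kLo + n)| ≤
        2 * c * A₁ * (2 : ℝ) ^ ((5 : ℝ) * ((kLo + n - 1 : ℤ) : ℝ) / 2) * q_top ^ 2) := by
    intro S hout
    refine ⟨fun i => ?_, fun i => ?_⟩
    · have := hout i (kLo - 1) (Or.inl (by omega)); rwa [hqlo] at this
    · have := hout i (kLo + n) (Or.inr le_rfl); rwa [hqhi] at this
  -- clause 19
  have h19 : ∀ (i : Fin 4) (j : Fin n), 0 ≤ Φ i j ∧ Φ i j ≤ env (kLo + (j : ℕ)) ∧
      Mw i j ^ 2 / 2 + η * Ψ (kLo + (j : ℕ)) +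
        η * (1 + 1 : ℝ) ^ ((2 : ℝ) * ((kLo + (j : ℕ) : ℤ) : ℝ)) * c * Φ i j < Φ i j := by
    intro i j
    refine ⟨hΦ0 i j, h19e i j, ?_⟩
    have h1 := mul_le_mul_of_nonneg_left (hΨB j) hη.le
    have h2 := hcap i j
    linarith
  -- the decrease clause in box form with the profile caps
  have hdec' : ∀ S : Fin 4 → ℤ → ℝ, v (fun i (j : Fin n) => S i (kLo + (j : ℕ))) ≤ 0 →
      (∀ (i : Fin 4) (k : ℤ), (k < kLo ∨ kLo + n ≤ k) → |S i k| ≤ q k) →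
      (∀ (i : Fin 4) (j : Fin n), S i (kLo + (j : ℕ)) ^ 2 ≤ 2 * Φ i j) →
      0 < g (fun i (j : Fin n) => S i (kLo + (j : ℕ))) →
      (fderiv ℝ v (fun i (j : Fin n) => S i (kLo + (j : ℕ))))
        (fun i (j : Fin n) => quadTerm 1 α (fun i' k' (_ : ℝ) => S i' k') i (kLo + (j : ℕ)) 0) ≤
        -(γ + δ) :=
    fun S hvS hout hbox hgS => hdec S hvS (hbd S hout).1 (hbd S hout).2 hbox hgS
  refine certificate₃_of_windowCertificateMarginSplit₃
    ⟨R, θ, c, η, γ, i₀, α, X₀, n, kLo, v, g, r, q, ρ, env, Ψ, Mw, Φ,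
      (fun S i (j : Fin n) => S i (kLo + (j : ℕ))),
      (fun S i k => quadTerm 1 α (fun i' k' (_ : ℝ) => S i' k') i k 0), Λ, δ,
      hR, hα, hX₀, hθ0, hθ, hc, hη, hγ, hkLo, hkn, fun _ _ _ => rfl, fun _ _ _ => rfl, hv, hg, h14,
      h15, h16, h17, h18, h19, h20, hv0, hg0, hproper, hfloor,
      WindowBox.decrease_of_box_le (kLo := kLo) hq0 hdec', hΛ, hΛ0, hbudget, ?_, ?_⟩
  · -- clause 26: tail rate below the window (profile kit)
    intro S F hreg i k hk
    exact h26 S F hreg.2.1 hreg.2.2.2.1 hreg.2.2.2.2 i k hk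
  · -- clause 27: goal ⇒ re-entry (window part on the box, outside part from the kit)
    intro S F hreg hgS
    obtain ⟨hvS, hSF, -, hout, hwin⟩ := hreg
    obtain ⟨hb1, hb2⟩ := WindowBox.region_bounds (kLo := kLo) hq0 hSF hout hwin
    obtain ⟨ha, hv', hg'⟩ := hgoal S hvS (hbd S hb1).1 (hbd S hb1).2 hb2 hgS
    exact ⟨ha, hv', hg', h27o F hout hwin |S i₀ 1| ha⟩

end Summit.NavierStokesRegularity.NavierStokesRegularity.Theorems

end
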